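import Literature.AnabelianGeometry.AbsoluteAnabelian.MLFClosureCompactFixedUnits
import Literature.AnabelianGeometry.AbsoluteAnabelian.MLFGaloisUnitsFunctors
import Literature.AnabelianGeometry.AbsoluteAnabelian.MonoidKummerMapsIdRigidTFProofs

/-!
# The natural functor `𝒞^MLF_TF → 𝒞^MLF_TM` (nonzero integral elements) of [AbsTopIII] Definition 3.1 (iii)

S. Mochizuki, *Topics in absolute anabelian geometry III*, §3, Def. 3.1 (iii) p. 68 (bib key
`MochizukiAbsTopIII2015`; locators = kurims manuscript pages, lit key `paper:url-5493eb38cbb7`):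
"… we thus obtain natural functors `𝒞^MLF_TF → 𝒞^MLF_TM`; … — i.e., by taking the multiplicative group
of nonzero integral elements [i.e., the elements `a ∈ k̄^×` such that `a^{-n}` fails to converge to
`0`, as `ℕ ∋ n → +∞`] of the arithmetic data, …".

This file (seat abc-iut-L4-t2; sub-DAG row P32.0.r0 of `plan/L4/SUBDAG-AbsTopIII-Prop32.md`, "TF ↦ TM
on ABSTRACT pairs") makes the FIRST of the four functors real, over the intrinsic `𝒪^⊳` of
`MLFGaloisIntrinsic.lean` (Rmk. 3.1.1 replaces "fails to converge" by divisibility at finite levels):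

* `GaloisFieldPair.submonoidPair`, `GaloisFieldPair.integersPair P hP = (Π ↷ 𝒪^⊳(P))` — OBJECTS, for
  every MLF-Galois `TF`-pair; `actionKer_integersPair` (the arithmetic quotients of `(Π ↷ k̄)` and
  `(Π ↷ 𝒪^⊳)` agree: every `x ∈ k̄^×` has `x` or `x⁻¹` in `𝒪^⊳`); `Iso.integersOfModel`,
  `isMLFGaloisMonoidPair_TM_integersPair` (it IS an MLF-Galois `TM`-pair); `Iso.integers`
  (functoriality on isomorphisms of pairs — unconditional);
* MORPHISMS (Def. 3.1 (ii)): `Hom.isIntrinsicUnit_map` / `Hom.isIntrinsicInteger_map` — a morphism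
  `φ : P → Q` maps intrinsic units/integers of `P` into those of `Q`, PROVIDED the saturations
  `φ_Π(U)·Ker_Q` of open subgroups `U ⊆ Π_P` — open in `Π_Q` by the typed "open injective homomorphism
  between the arithmetic Galois groups" — have FINITE INDEX in `Π_Q` (hypothesis `hfin`); proof:
  `x ∈ 𝒪^×` has `ℓ^n`-th roots fixed by `Stab(x)`, their images are fixed by `φ_Π(Stab x)·Ker_Q`, which
  cuts out a finite extension of `k_Q` exactly when it has finite index
  (`MLFClosureCompactFixedUnits`), where infinitely `ℓ`-divisible elements are units (Rmk. 3.1.1).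
  `hfin` holds when `Π_Q` is compact (`finiteIndex_sat_of_compactSpace`: étale, i.e. profinite, `Π` —
  all of `𝒞^{MLF-hyp}`, `𝒞^{MLF-sB}`) and when the arithmetic Galois group `Π_Q/Ker_Q` is compact
  (`finiteIndex_sat_of_compactSpace_quotient`: e.g. tempered `Π` over a profinite `G_k`).  It does NOT
  follow from the typed axioms alone: Def. 3.1 (i) lets `Π_k` be ANY topological group with a
  continuous surjection `ε_k : Π_k ↠ G_k` (e.g. `G_k` made discrete), for which "open in `Π_Q`" carries
  no finiteness — print has the same latitude and intends the arithmetic Galois group `G ≅ G_k`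
  profinite (Def. 3.1 (ii)); we therefore type the functor on the full subcategory of `𝒞^MLF_TF` with
  COMPACT Galois group, `MLFGaloisFieldPairCompactCat`, which contains every category the functor is
  applied to in print (Prop. 3.2 (v), Cor. 3.6: `𝒞^{MLF-sB}`);
* `Hom.integers`, the FUNCTOR `tfToTM : MLFGaloisFieldPairCompactCat ⥤ MLFGaloisMonoidPairCat TM`,
  compatible with `(Π ↷ M) ↦ Π` on the nose (`tfToTM_homPi`).

Deliberately NOT here: `𝒞_TLG → 𝒞_TCG` (same mechanism on the group `k̄^×`; next file of this seat).
HONEST FRAMING: OUR kernel constructions of classical objects named by a refereed 2015 paper; nothing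
here bears on [IUTchIII] Cor. 3.12; typed ≠ proved for anything downstream.
-/

noncomputable section

universe u

namespace Literature.AnabelianGeometry.AbsoluteAnabelian

open _root_.CategoryTheory
open _root_.ValuativeRel
open Literature.NumberTheory.GaloisRepresentations

/-! ### Objects: `(Π ↷ M) ↦ (Π ↷ 𝒪^⊳)` -/

namespace GaloisFieldPair

variable (P : GaloisFieldPair.{u}) {Q R : GaloisFieldPair.{u}}

/-- The action of `Π` on a `Π`-stable submonoid `S` of the field `M` of a `TF`-pair, by monoid
automorphisms. [cite: MochizukiAbsTopIII2015, Definition 3.1 (iii) p.68] -/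
@[reducible] def submonoidAction (S : Submonoid P.M) (hS : ∀ (g : P.Pi) {x : P.M}, x ∈ S → g • x ∈ S) :
    MulDistribMulAction P.Pi S where
  smul g x := ⟨g • (x : P.M), hS g x.2⟩
  one_smul x := Subtype.ext (one_smul P.Pi (x : P.M))
  mul_smul g h x := Subtype.ext (mul_smul g h (x : P.M))
  smul_mul g x y := Subtype.ext (smul_mul' g (x : P.M) (y : P.M))
  smul_one g := Subtype.ext (smul_one g)

/-- The pair `(Π ↷ S)` cut out of a `TF`-pair `(Π ↷ M)` by a `Π`-stable submonoid `S ⊆ M` (a pair of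
`TCG/TLG/TM`-shape; the stabiliser of `x ∈ S` is the open stabiliser of `x ∈ M`).
[cite: MochizukiAbsTopIII2015, Definition 3.1 (iii) p.68] -/
abbrev submonoidPair (S : Submonoid P.M) (hS : ∀ (g : P.Pi) {x : P.M}, x ∈ S → g • x ∈ S) :
    GaloisMonoidPair.{u} where
  Pi := P.Pi
  M := S
  instAction := P.submonoidAction S hS
  isOpen_stabilizer x := by
    convert P.isOpen_stabilizer (x : P.M) using 1
    ext g
    exact Subtype.ext_iff

variable {P} in
/-- `Π` preserves the intrinsic non-zero integers (non-vanishing and `IsIntrinsicInteger.smul`).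
[cite: MochizukiAbsTopIII2015, Definition 3.1 (iii) p.68] -/
theorem smul_mem_intrinsicNonzeroIntegers (hP : IsMLFGaloisFieldPair P) (g : P.Pi) {x : P.M}
    (hx : x ∈ P.intrinsicNonzeroIntegers hP) : g • x ∈ P.intrinsicNonzeroIntegers hP :=
  ⟨fun h0 => hx.1 (by simpa using congrArg (fun z => g⁻¹ • z) h0), hx.2.smul g⟩

/-- **Def 3.1 (iii), `𝒞^MLF_TF → 𝒞^MLF_TM` on objects: `(Π ↷ M) ↦ (Π ↷ 𝒪^⊳)`**, the pair of intrinsic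
non-zero integers of an MLF-Galois `TF`-pair ("by taking the multiplicative group of nonzero integral
elements … of the arithmetic data"). [cite: MochizukiAbsTopIII2015, Definition 3.1 (iii) p.68] -/
abbrev integersPair (hP : IsMLFGaloisFieldPair P) : GaloisMonoidPair.{u} :=
  P.submonoidPair (P.intrinsicNonzeroIntegers hP) (fun g _ hx => smul_mem_intrinsicNonzeroIntegers hP g hx)

/-- The topological group of `P.integersPair` is that of `P`. [cite: MochizukiAbsTopIII2015, Definition 3.1 (iii) p.68] -/
theorem integersPair_Pi (hP : IsMLFGaloisFieldPair P) : (P.integersPair hP).Pi = P.Pi := rfl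

/-- The arithmetic data of `P.integersPair` is the intrinsic `𝒪^⊳`. [cite: MochizukiAbsTopIII2015, Definition 3.1 (iii) p.68] -/
theorem integersPair_M (hP : IsMLFGaloisFieldPair P) :
    (P.integersPair hP).M = P.intrinsicNonzeroIntegers hP := rfl

variable {P}

/-- For an MLF-Galois `TF`-pair every non-zero `x` has `x ∈ 𝒪^⊳` or `x⁻¹ ∈ 𝒪^⊳` (transport of the
valuation dichotomy of `k̄`, `MLFClosure.mem_nonzeroIntegers_or_inv_mem`).
[cite: MochizukiAbsTopIII2015, Definition 3.1 (iii) p.68] -/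
theorem mem_intrinsicNonzeroIntegers_or_inv_mem (hP : IsMLFGaloisFieldPair P) {x : P.M} (hx : x ≠ 0) :
    x ∈ P.intrinsicNonzeroIntegers hP ∨ x⁻¹ ∈ P.intrinsicNonzeroIntegers hP := by
  obtain ⟨C, D, ⟨e⟩⟩ := hP.exists_model
  have hx' : e.isoM.symm x ≠ 0 := (map_ne_zero_iff _ e.isoM.symm.injective).mpr hx
  rw [← map_nonzeroIntegers_eq_intrinsicNonzeroIntegers C D hP e]
  rcases C.mem_nonzeroIntegers_or_inv_mem hx' with h | h
  · exact Or.inl ⟨e.isoM.symm x, h, e.isoM.apply_symm_apply x⟩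
  · refine Or.inr ⟨e.isoM.symm x⁻¹, ?_, e.isoM.apply_symm_apply _⟩
    rwa [map_inv₀]

/-- **The arithmetic quotients of `(Π ↷ M)` and `(Π ↷ 𝒪^⊳)` agree** (`M = Frac 𝒪^⊳`: an automorphism fixing
`𝒪^⊳` fixes `x` or `x⁻¹` for every `x ≠ 0`). [cite: MochizukiAbsTopIII2015, Definition 3.1 (ii) p.67] -/
theorem actionKer_integersPair (hP : IsMLFGaloisFieldPair P) : (P.integersPair hP).actionKer = P.actionKer := by
  ext g
  rw [GaloisMonoidPair.mem_actionKer_iff, GaloisFieldPair.mem_actionKer_iff]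
  constructor
  · intro h x
    rcases eq_or_ne x 0 with rfl | hx0
    · exact smul_zero g
    rcases mem_intrinsicNonzeroIntegers_or_inv_mem hP hx0 with hx | hx
    · exact congrArg Subtype.val (h ⟨x, hx⟩)
    · have h1 := congrArg Subtype.val (h ⟨x⁻¹, hx⟩)
      change HSMul.hSMul (α := P.Pi) (β := P.M) g x⁻¹ = x⁻¹ at h1
      rw [smul_inv''] at h1
      exact inv_injective h1
  · intro h m
    exact Subtype.ext (h (m : P.M))

/-- **Functoriality on isomorphisms of pairs** (unconditional): `(Π ↷ M) ≅ (Π' ↷ M')` induces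
`(Π ↷ 𝒪^⊳) ≅ (Π' ↷ 𝒪'^⊳)` (intrinsic integers are transported, `isIntrinsicInteger_iff_of_iso`).
[cite: MochizukiAbsTopIII2015, Definition 3.1 (iii) p.68] -/
def Iso.integers (e : GaloisFieldPair.Iso P Q) (hP : IsMLFGaloisFieldPair P) (hQ : IsMLFGaloisFieldPair Q) :
    GaloisMonoidPair.Iso (P.integersPair hP) (Q.integersPair hQ) where
  isoPi := e.isoPi
  isoM :=
    { toFun := fun m => ⟨e.isoM m, (e.isoM.map_ne_zero_iff).mpr m.2.1,
        (GaloisFieldPair.isIntrinsicInteger_iff_of_iso e _).mp m.2.2⟩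
      invFun := fun m => ⟨e.isoM.symm m, (e.isoM.symm.map_ne_zero_iff).mpr m.2.1,
        (GaloisFieldPair.isIntrinsicInteger_iff_of_iso e.symm _).mp m.2.2⟩
      left_inv := fun m => Subtype.ext (e.isoM.symm_apply_apply (m : P.M))
      right_inv := fun m => Subtype.ext (e.isoM.apply_symm_apply (m : Q.M))
      map_mul' := fun m m' => Subtype.ext (map_mul e.isoM (m : P.M) (m' : P.M)) }
  smul_comm g m := Subtype.ext (e.smul_comm g (m : P.M))

/-- The Galois component of `e.integers` is that of `e`. [cite: MochizukiAbsTopIII2015, Definition 3.1 (iii) p.68] -/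
@[simp] theorem Iso.integers_isoPi (e : GaloisFieldPair.Iso P Q) (hP hQ) :
    (e.integers hP hQ).isoPi = e.isoPi := rfl

/-- The object component of `e.integers` on underlying elements. [cite: MochizukiAbsTopIII2015, Definition 3.1 (iii) p.68] -/
@[simp] theorem Iso.integers_isoM_coe (e : GaloisFieldPair.Iso P Q) (hP hQ) (m : (P.integersPair hP).M) :
    ((e.integers hP hQ).isoM m : Q.M) = e.isoM (m : P.M) := rfl

end GaloisFieldPair

/-! ### The model: `(Π_k ↷ k̄) ↦ (Π_k ↷ 𝒪_k̄^⊳)` is the model `TM`-pair -/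

namespace ModelMLFGaloisData

variable (C : MLFClosure.{u}) (D : ModelMLFGaloisData C.k C.K) {P : GaloisFieldPair.{u}}

/-- **On the model the functor is Def 3.1 (i)**: an isomorphism `(Π_k ↷ k̄) ⥲ P` induces
`(Π_k ↷ 𝒪_k̄^⊳) ⥲ (Π_P ↷ 𝒪^⊳(P))` — it carries `𝒪_k̄^⊳` onto the intrinsic `𝒪^⊳`
(`map_nonzeroIntegers_eq_intrinsicNonzeroIntegers`). [cite: MochizukiAbsTopIII2015, Definition 3.1 (iii) p.68] -/
def isoIntegersOfModel (e : GaloisFieldPair.Iso D.fieldPair P) (hP : IsMLFGaloisFieldPair P) :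
    GaloisMonoidPair.Iso D.tmPair (P.integersPair hP) where
  isoPi := e.isoPi
  isoM :=
    { toFun := fun m =>
        ⟨e.isoM (m : C.K), (e.isoM.map_ne_zero_iff).mpr m.2.2,
          (GaloisFieldPair.isIntrinsicInteger_iff_of_iso e (m : C.K)).mp
            ((D.ne_zero_and_isIntrinsicInteger_fieldPair_iff C (m : C.K)).mpr m.2).2⟩
      invFun := fun y =>
        ⟨e.isoM.symm (y : P.M),
          (D.ne_zero_and_isIntrinsicInteger_fieldPair_iff C _).mp
            ⟨(e.isoM.symm.map_ne_zero_iff).mpr y.2.1,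
              (GaloisFieldPair.isIntrinsicInteger_iff_of_iso e.symm (y : P.M)).mp y.2.2⟩⟩
      left_inv := fun m => Subtype.ext (e.isoM.symm_apply_apply (m : C.K))
      right_inv := fun y => Subtype.ext (e.isoM.apply_symm_apply (y : P.M))
      map_mul' := fun m m' => Subtype.ext (map_mul e.isoM (m : C.K) (m' : C.K)) }
  smul_comm g m := Subtype.ext (e.smul_comm g (m : C.K))

/-- **Def 3.1 (iii) preserves MLF-Galois pairs, `TF ↦ TM`**: the pair of intrinsic non-zero integers of an
MLF-Galois `TF`-pair is an MLF-Galois `TM`-pair. [cite: MochizukiAbsTopIII2015, Definition 3.1 (iii) p.68] -/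
theorem _root_.Literature.AnabelianGeometry.AbsoluteAnabelian.GaloisFieldPair.isMLFGaloisMonoidPair_TM_integersPair
    {P : GaloisFieldPair.{u}} (hP : IsMLFGaloisFieldPair P) :
    IsMLFGaloisMonoidPair .TM (P.integersPair hP) := by
  obtain ⟨C, D, ⟨e⟩⟩ := hP.exists_model
  exact ⟨⟨C, D, D.tmPair, D.monoidPair_TM, ⟨isoIntegersOfModel C D e hP⟩⟩⟩

end ModelMLFGaloisData

/-! ### Morphisms: a morphism of pairs maps `𝒪^⊳` into `𝒪^⊳` -/

namespace GaloisFieldPair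

variable {P Q R : GaloisFieldPair.{u}}

/-- If `S ⊆ Π_P` fixes `y`, then the saturation `φ_Π(S)·Ker_Q` fixes `φ_M(y)` (equivariance of `φ`).
[cite: MochizukiAbsTopIII2015, Definition 3.1 (ii) p.67] -/
theorem Hom.smul_map_eq_of_mem_sup (φ : P.Hom Q) (S : Subgroup P.Pi) {y : P.M}
    (hy : ∀ g ∈ S, g • y = y) {h : Q.Pi} (hh : h ∈ S.map φ.homPi ⊔ Q.actionKer) :
    h • φ.homM y = φ.homM y := by
  have hle : S.map φ.homPi ⊔ Q.actionKer ≤ MulAction.stabilizer Q.Pi (φ.homM y) := by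
    refine sup_le ?_ ?_
    · intro h' hh'
      obtain ⟨g, hg, rfl⟩ := Subgroup.mem_map.mp hh'
      rw [MulAction.mem_stabilizer_iff, ← φ.smul_comm, hy g hg]
    · intro h' hh'
      rw [MulAction.mem_stabilizer_iff]
      exact (GaloisFieldPair.mem_actionKer_iff Q h').mp hh' _
  exact hle hh

/-- **A morphism of pairs maps intrinsic units into intrinsic units**, for an MLF-Galois target whose
Galois group gives the saturations `φ_Π(U)·Ker_Q` of open subgroups FINITE INDEX (`hfin`; automatic for
compact `Π_Q` or compact arithmetic Galois group, see below): the `ℓ^n`-th roots of `x` fixed by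
`Stab(x)` map to `ℓ^n`-th roots of `φ_M(x)` fixed by `φ_Π(Stab x)·Ker_Q`, which cuts out a finite
extension of `k_Q`, where Rmk 3.1.1 applies. [cite: MochizukiAbsTopIII2015, Definition 3.1 (iii) p.68] -/
theorem Hom.isIntrinsicUnit_map (φ : P.Hom Q) (hQ : IsMLFGaloisFieldPair Q)
    (hfin : ∀ U : Subgroup P.Pi, IsOpen (U : Set P.Pi) → (U.map φ.homPi ⊔ Q.actionKer).FiniteIndex)
    {x : P.M} (hx : P.IsIntrinsicUnit x) : Q.IsIntrinsicUnit (φ.homM x) := by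
  obtain ⟨hx0, ℓ, hℓ, hroots⟩ := hx
  obtain ⟨C, D, ⟨e⟩⟩ := hQ.exists_model
  set S : Subgroup P.Pi := MulAction.stabilizer P.Pi x with hS
  set H : Subgroup Q.Pi := S.map φ.homPi ⊔ Q.actionKer with hH
  haveI hHfin : H.FiniteIndex := hfin S (P.isOpen_stabilizer x)
  set H' : Subgroup D.fieldPair.Pi := H.comap e.isoPi.toMonoidHom with hH'
  haveI : H'.FiniteIndex := by
    rw [Subgroup.finiteIndex_iff, hH',
      Subgroup.index_comap_of_surjective _ e.isoPi.surjective]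
    exact hHfin.index_ne_zero
  -- elements of `H'` fix the pull-backs to `(Π_k ↷ k̄)` of the `φ_M(y)`, `y` fixed by `S`
  have hfixD : ∀ y : P.M, (∀ g ∈ S, g • y = y) →
      ∀ g ∈ H', g • e.isoM.symm (φ.homM y) = e.isoM.symm (φ.homM y) := by
    intro y hy g hg
    apply e.isoM.injective
    rw [e.smul_comm, RingEquiv.apply_symm_apply]
    exact φ.smul_map_eq_of_mem_sup S hy (Subgroup.mem_comap.mp hg)
  have hz0 : e.isoM.symm (φ.homM x) ≠ 0 :=
    (e.isoM.symm.map_ne_zero_iff).mpr ((map_ne_zero φ.homM).mpr hx0)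
  have h1 : D.fieldPair.IsIntrinsicUnit (e.isoM.symm (φ.homM x)) :=
    D.fieldPair_isIntrinsicUnit_of_forall_exists_pow_eq_fixed C H' hz0 hℓ fun n => by
      obtain ⟨y, hy, hyx⟩ := hroots n
      refine ⟨e.isoM.symm (φ.homM y), hfixD y (fun g hg => hy g hg), ?_⟩
      rw [← map_pow, ← map_pow, hyx]
  have h2 := (GaloisFieldPair.isIntrinsicUnit_iff_of_iso e _).mp h1
  rwa [RingEquiv.apply_symm_apply] at h2

/-- A morphism maps intrinsic integers into intrinsic integers (same hypotheses; `φ_M(1 + x) = 1 + φ_M(x)`).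
[cite: MochizukiAbsTopIII2015, Definition 3.1 (iii) p.68] -/
theorem Hom.isIntrinsicInteger_map (φ : P.Hom Q) (hQ : IsMLFGaloisFieldPair Q)
    (hfin : ∀ U : Subgroup P.Pi, IsOpen (U : Set P.Pi) → (U.map φ.homPi ⊔ Q.actionKer).FiniteIndex)
    {x : P.M} (hx : P.IsIntrinsicInteger x) : Q.IsIntrinsicInteger (φ.homM x) := by
  rcases hx with h | h
  · exact Or.inl (φ.isIntrinsicUnit_map hQ hfin h)
  · refine Or.inr ?_
    rw [← map_one φ.homM, ← map_add]
    exact φ.isIntrinsicUnit_map hQ hfin h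

/-- `hfin` for a target with COMPACT `Π` (étale/profinite Galois groups: `𝒞^{MLF-hyp}`, `𝒞^{MLF-sB}`): the
saturation of an open subgroup is open (Def 3.1 (ii)), hence of finite index.
[cite: MochizukiAbsTopIII2015, Definition 3.1 (ii) p.67] -/
theorem Hom.finiteIndex_sat_of_compactSpace (φ : P.Hom Q) [CompactSpace Q.Pi] (U : Subgroup P.Pi)
    (hU : IsOpen (U : Set P.Pi)) : (U.map φ.homPi ⊔ Q.actionKer).FiniteIndex :=
  haveI : Finite (Q.Pi ⧸ (U.map φ.homPi ⊔ Q.actionKer)) :=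
    Subgroup.quotient_finite_of_isOpen _ (φ.isOpen_image U hU)
  Subgroup.finiteIndex_of_finite_quotient

/-- `hfin` for a target with compact ARITHMETIC GALOIS GROUP `Π_Q/Ker_Q` (quotient topology; e.g. a
tempered `Π` over a profinite `G_k`). [cite: MochizukiAbsTopIII2015, Definition 3.1 (ii) p.67] -/
theorem Hom.finiteIndex_sat_of_compactSpace_quotient (φ : P.Hom Q) [CompactSpace (Q.Pi ⧸ Q.actionKer)]
    (U : Subgroup P.Pi) (hU : IsOpen (U : Set P.Pi)) : (U.map φ.homPi ⊔ Q.actionKer).FiniteIndex :=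
  haveI : Q.actionKer.Normal := by
    unfold GaloisFieldPair.actionKer
    infer_instance
  finiteIndex_of_isOpen_of_compactSpace_quotient Q.actionKer _ le_sup_right (φ.isOpen_image U hU)

/-- **Def 3.1 (iii), `𝒞^MLF_TF → 𝒞^MLF_TM` on morphisms**: `φ = (φ_Π, φ_M) ↦ (φ_Π, φ_M|_{𝒪^⊳})`, for
MLF-Galois `P`, `Q` and `hfin` as in `Hom.isIntrinsicUnit_map`.
[cite: MochizukiAbsTopIII2015, Definition 3.1 (iii) p.68] -/
def Hom.integers (φ : P.Hom Q) (hP : IsMLFGaloisFieldPair P) (hQ : IsMLFGaloisFieldPair Q)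
    (hfin : ∀ U : Subgroup P.Pi, IsOpen (U : Set P.Pi) → (U.map φ.homPi ⊔ Q.actionKer).FiniteIndex) :
    (P.integersPair hP).Hom (Q.integersPair hQ) where
  homPi := φ.homPi
  continuous_homPi := φ.continuous_homPi
  homM :=
    { toFun := fun m => ⟨φ.homM (m : P.M), (map_ne_zero φ.homM).mpr m.2.1,
        φ.isIntrinsicInteger_map hQ hfin m.2.2⟩
      map_one' := Subtype.ext (map_one φ.homM)
      map_mul' := fun m m' => Subtype.ext (map_mul φ.homM _ _) }
  smul_comm g m := Subtype.ext (φ.smul_comm g (m : P.M))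
  comap_ker := by
    rw [actionKer_integersPair hQ, actionKer_integersPair hP]
    exact φ.comap_ker
  isOpen_image U hU := by
    rw [actionKer_integersPair hQ]
    exact φ.isOpen_image U hU

/-- The Galois component of `φ.integers` is `φ_Π`. [cite: MochizukiAbsTopIII2015, Definition 3.1 (iii) p.68] -/
@[simp] theorem Hom.integers_homPi (φ : P.Hom Q) (hP hQ hfin) : (φ.integers hP hQ hfin).homPi = φ.homPi := rfl

/-- The object component of `φ.integers` on underlying elements is `φ_M`. [cite: MochizukiAbsTopIII2015, Definition 3.1 (iii) p.68] -/
@[simp] theorem Hom.integers_homM_coe (φ : P.Hom Q) (hP hQ hfin) (m : (P.integersPair hP).M) :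
    ((φ.integers hP hQ hfin).homM m : Q.M) = φ.homM (m : P.M) := rfl

end GaloisFieldPair

/-! ### Def 3.1 (iii): the functor `𝒞^MLF_TF → 𝒞^MLF_TM` on pairs with compact Galois group -/

/-- The full subcategory of `𝒞^MLF_TF` of MLF-Galois `TF`-pairs with COMPACT Galois group `Π` (contains
`𝒞^{MLF-hyp}_TF ⊇ 𝒞^{MLF-sB}_TF`: étale fundamental groups are profinite).
[cite: MochizukiAbsTopIII2015, Definition 3.1 (iii) p.67] -/
def MLFGaloisFieldPairCompactCat : Type (u + 1) :=
  ObjectProperty.FullSubcategory (fun P : GaloisFieldPair.{u} => IsMLFGaloisFieldPair P ∧ CompactSpace P.Pi)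

/-- The category structure (full subcategory of the category of `TF`-pairs).
[cite: MochizukiAbsTopIII2015, Definition 3.1 (iii) p.67] -/
instance : Category MLFGaloisFieldPairCompactCat.{u} :=
  inferInstanceAs (Category (ObjectProperty.FullSubcategory _))

/-- **Def 3.1 (iii): the natural functor `𝒞^MLF_TF → 𝒞^MLF_TM`, `(Π ↷ M) ↦ (Π ↷ 𝒪^⊳)`**, on MLF-Galois
`TF`-pairs with compact Galois group ("by taking the multiplicative group of nonzero integral elements …
of the arithmetic data"); on morphisms `(φ_Π, φ_M) ↦ (φ_Π, φ_M|_{𝒪^⊳})`.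
[cite: MochizukiAbsTopIII2015, Definition 3.1 (iii) p.68] -/
def tfToTM : MLFGaloisFieldPairCompactCat.{u} ⥤ MLFGaloisMonoidPairCat.{u} .TM where
  obj P := ⟨P.obj.integersPair P.property.1,
    GaloisFieldPair.isMLFGaloisMonoidPair_TM_integersPair P.property.1⟩
  map {P Q} φ := InducedCategory.homMk
    (GaloisFieldPair.Hom.integers (P := P.obj) (Q := Q.obj) φ.hom P.property.1 Q.property.1
      (fun U hU => by
        haveI := Q.property.2
        exact GaloisFieldPair.Hom.finiteIndex_sat_of_compactSpace (P := P.obj) (Q := Q.obj) φ.hom U hU))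
  map_id _ := InducedCategory.Hom.ext (GaloisMonoidPair.Hom.ext rfl (MonoidHom.ext fun _ => Subtype.ext rfl))
  map_comp _ _ := InducedCategory.Hom.ext (GaloisMonoidPair.Hom.ext rfl (MonoidHom.ext fun _ => Subtype.ext rfl))

/-- `tfToTM` is compatible with the forgetful assignment `(Π ↷ M) ↦ Π` ON THE NOSE (same `Π`, same `φ_Π`).
[cite: MochizukiAbsTopIII2015, Definition 3.1 (iii) p.68] -/
theorem tfToTM_homPi {P Q : MLFGaloisFieldPairCompactCat.{u}} (φ : P ⟶ Q) :
    (tfToTM.map φ).hom.homPi = GaloisFieldPair.Hom.homPi (P := P.obj) (Q := Q.obj) φ.hom := rfl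

end Literature.AnabelianGeometry.AbsoluteAnabelian

end
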